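import Mathlib
import Summits.Ventures.HodgeRepro2.T5ConductorFormula
import Summits.Ventures.HodgeRepro2.T5RamificationIndexUniformizer

/-!
# The conductor formula with Mathlib's ramification index and different exponent

Tier-5 support for the (A6) step of §N5.12.6 / §N5.13.2 (route/T5-route-2.md l. 455:
«n(ψ_v ∘ tr_{E_v/F_v}) = 2 n(ψ_v) + d(E_v/F_v) with d the different exponent»): the conductor
formula `T5ConductorFormula.conductorExp_comp_trace_eq` (p395064's bookkeeping + p394400's trace
dual) restated for a pair of DISCRETE VALUATION RINGS with

* `e` = Mathlib's `Ideal.ramificationIdx' (ϖ) (π)` (via `T5RamificationIndexUniformizer`,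
  p395019: `ramificationIdx' = e ⟺ ϖ = u · π^e`, and `T5RamifiedQuadraticDictionary`, p394885:
  `ϖ = u · π^e ⇒ v_E ϖ = exp (-e)`), and
* `d` = the different exponent, `differentIdeal A B = (π ^ d)`,

and its quadratic ramified case `n(ψ ∘ Tr) = 2 n(ψ) + d` (`e = 2`), which is the owner's line.
Remaining hypotheses: the AKLB DVR pair, `A` / `B` the valuation rings of `v_F` / `v_E`
normalised on the uniformisers, `ψ_F` trivial on some ball and non-trivial.

Uses an L-value-free non-vanishing device: NO.
-/

namespace Summit.Ventures.HodgeRepro2.T5ConductorFormulaDVR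

open WithZero

variable (A K L B : Type*) [CommRing A] [Field K] [CommRing B] [Field L]
  [Algebra A K] [Algebra B L] [Algebra A B] [Algebra K L] [Algebra A L]
  [IsScalarTower A K L] [IsScalarTower A B L]
  [IsDomain A] [IsDiscreteValuationRing A] [IsFractionRing A K]
  [FiniteDimensional K L] [Algebra.IsSeparable K L] [IsIntegralClosure B A L]
  [IsDomain B] [IsDiscreteValuationRing B] [IsFractionRing B L] [Module.IsTorsionFree A B]
  (vF : Valuation K (WithZero (Multiplicative ℤ))) (vE : Valuation L (WithZero (Multiplicative ℤ)))

omit [IsDomain A] [IsDiscreteValuationRing A] [IsFractionRing A K] [FiniteDimensional K L]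
  [Algebra.IsSeparable K L] [IsIntegralClosure B A L] [IsDomain B] [IsDiscreteValuationRing B]
  [IsFractionRing B L] [Algebra A K] [Algebra K L] [IsScalarTower A K L]
  [Module.IsTorsionFree A B] in
/-- `v_E ϖ = exp (-e)` from the uniformiser relation `ϖ = u · π^e` (p394885). -/
theorem val_algebraMap_eq_exp_neg_of_eq_unit_mul_pow (hB : vE.Integers B) (ϖ : A) (π : B)
    (hπ : vE (algebraMap B L π) = exp (-1 : ℤ)) (u : Bˣ) (e : ℕ)
    (h : algebraMap A B ϖ = u * π ^ e) : vE (algebraMap A L ϖ) = exp (-(e : ℤ)) := by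
  have := T5RamifiedQuadraticDictionary.val_algebraMap_unit_mul_pow vE (fun b => hB.map_le_one b)
    ϖ π hπ u e h 1 1
  simpa using this

omit [IsDomain A] [IsDiscreteValuationRing A] [IsFractionRing A K] [FiniteDimensional K L]
  [Algebra.IsSeparable K L] [IsIntegralClosure B A L] [IsDomain B] [IsDiscreteValuationRing B]
  [IsFractionRing B L] [Algebra A K] [Algebra K L] [Algebra A L] [IsScalarTower A K L]
  [IsScalarTower A B L] [Algebra A B] [Module.IsTorsionFree A B] in
/-- `v_E (π ^ d) = exp (-d)`. -/
theorem val_algebraMap_pow (π : B) (hπ : vE (algebraMap B L π) = exp (-1 : ℤ)) (d : ℕ) :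
    vE (algebraMap B L (π ^ d)) = exp (-(d : ℤ)) := by
  rw [map_pow, Valuation.map_pow, hπ, ← exp_nsmul]
  congr 1
  simp

/-- THE CONDUCTOR FORMULA for a DVR pair: `n(ψ ∘ Tr) = e · n(ψ) + d` with
`e = ramificationIdx' (ϖ) (π)` and `𝔇 = (π ^ d)`. -/
theorem conductorExp_comp_trace_eq_of_ramificationIdx' {M : Type*} [Monoid M] (ψ : AddChar K M)
    (hA : vF.Integers A) (hB : vE.Integers B)
    (ϖ : A) (hϖ : Irreducible ϖ) (hϖF : vF (algebraMap A K ϖ) = exp (-1 : ℤ))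
    (π : B) (hπ : Irreducible π) (hπv : vE (algebraMap B L π) = exp (-1 : ℤ))
    (e : ℕ) (he : (Ideal.span {ϖ}).ramificationIdx' (Ideal.span {π}) = e)
    (d : ℕ) (hd : differentIdeal A B = Ideal.span {π ^ d})
    (h₀ : ∃ k : ℤ, ∀ y : K, vF y ≤ exp k → ψ y = 1) (hψ : ∃ y : K, ψ y ≠ 1) :
    T5AdditiveConductor.conductorExp (ψ.compAddMonoidHom (Algebra.trace K L).toAddMonoidHom) vE =
      (e : ℤ) * T5AdditiveConductor.conductorExp ψ vF + d := by
  obtain ⟨u, hu⟩ := (T5RamificationIndexUniformizer.ramificationIdx'_eq_iff ϖ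
    (T5RamificationIndexUniformizer.algebraMap_ne_zero A K L B ϖ hϖ) π hπ e).mp he
  exact T5ConductorFormula.conductorExp_comp_trace_eq A K L B vF vE ψ hA hB ϖ hϖF e
    (val_algebraMap_eq_exp_neg_of_eq_unit_mul_pow A L B vE hB ϖ π hπv u e hu) π hπv (π ^ d) hd
    (pow_ne_zero d hπ.ne_zero) d (val_algebraMap_pow L B vE π hπv d) h₀ hψ

/-- The owner's line (A6): at a RAMIFIED QUADRATIC place (`[L : K] = 2`, `e = 2`),
`n(ψ ∘ Tr) = 2 n(ψ) + d`. -/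
theorem conductorExp_comp_trace_eq_two_mul_add (h2 : Module.finrank K L = 2) {M : Type*}
    [Monoid M] (ψ : AddChar K M) (hA : vF.Integers A) (hB : vE.Integers B)
    (ϖ : A) (hϖ : Irreducible ϖ) (hϖF : vF (algebraMap A K ϖ) = exp (-1 : ℤ))
    (π : B) (hπ : Irreducible π) (hπv : vE (algebraMap B L π) = exp (-1 : ℤ))
    (hf : (Ideal.span {ϖ}).inertiaDeg' (Ideal.span {π}) = 1)
    (d : ℕ) (hd : differentIdeal A B = Ideal.span {π ^ d})
    (h₀ : ∃ k : ℤ, ∀ y : K, vF y ≤ exp k → ψ y = 1) (hψ : ∃ y : K, ψ y ≠ 1) :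
    T5AdditiveConductor.conductorExp (ψ.compAddMonoidHom (Algebra.trace K L).toAddMonoidHom) vE =
      2 * T5AdditiveConductor.conductorExp ψ vF + d := by
  have he := (T5RamificationIndexUniformizer.ramificationIdx'_eq_two_iff_inertiaDeg'_eq_one
    A K L B h2 ϖ hϖ π hπ).mpr hf
  have := conductorExp_comp_trace_eq_of_ramificationIdx' A K L B vF vE ψ hA hB ϖ hϖ hϖF π hπ hπv
    2 he d hd h₀ hψ
  rw [this]
  push_cast
  ring

end Summit.Ventures.HodgeRepro2.T5ConductorFormulaDVR
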